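import Literature.NumberTheory.Transcendental.Waldschmidt1980Main
import HarnessLib

/-!
# Waldschmidt 1980, Proposition 3.8 over `ℚ` (`q = 2`): the statement in the shape `hW₂`

Support file (one plain definition and theorems; no named facts) for the archimedean input of
the Stewart–Yu 1991 line of `Literature.Barriers.ABC.stewartYu1991_upperBound`: M. Waldschmidt,
*A lower bound for linear forms in logarithms*, Acta Arith. **37** (1980), 257–283, Proposition
3.8 (p. 263) specialised to `K = ℚ`, `D = 1`, `q = 2`, `E = e`, in the shape of the binder `hW₂`
of `Literature.Barriers.ABC.stewartYu1991_of_yu1990_waldschmidt1980`: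

for positive rationals `α₀, …, αₙ ≠ 1` with `[ℚ(√α₀, …, √αₙ) : ℚ] = 2^{n+1}` (Kummer's condition),
sizes `1 ≤ V₀ ≤ ⋯ ≤ Vₙ` with `max(h(αⱼ), |log αⱼ|) ≤ Vⱼ`, integers `bⱼ` with `h(bⱼ) ≤ W` (`W > 0`)
and `Λ = ∑ bⱼ log αⱼ ≠ 0`,
`|Λ| > exp(−C(n+1) V₀⋯Vₙ (W + log(2Vₙ)) log(2V_{n−1}) / (log 2)^{n+2})` with **`C(m) = (2⁷⁰ m)ᵐ`**
— the dependence `(cm)ᵐ` in the number of logarithms and `log V_{n−1}` (not `log Vₙ`) in the last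
factor, which is what Stewart–Yu 1991 consume.

The proof restricts to the support of `b`, takes for `θ` the logarithm of the largest index in the
support (the largest size), and applies the machine `CW77.Setup.W80Hyp.main` of
`Waldschmidt1980Main.lean`; a single non-zero coefficient is the elementary bound
`|log α| ≥ 1/H(α)`.

## References

* [Waldschmidt1980] M. Waldschmidt, *A lower bound for linear forms in logarithms*, Acta Arith. 37
  (1980), 257–283 — Proposition 3.8 (p. 263) and Corollaire 1.2.
-/

noncomputable section

open Finset Real Height
open Literature.NumberTheory.Transcendental.CW77
open Literature.NumberTheory.Transcendental.Waldschmidt1980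
open Literature.NumberTheory.Transcendental.Waldschmidt1980.W80Par

namespace Literature.NumberTheory.Transcendental.Waldschmidt1980

/-! ### The constant -/

/-- **The constant of Proposition 3.8 over `ℚ` as a function of the number `m` of logarithms:
`C(m) = (2⁷⁰ m)ᵐ`.** [cite: Waldschmidt1980, Prop. 3.8 (C(n) = 2^{8n+51} n^{2n})] -/
def w80Cw (m : ℕ) : ℝ := (2 ^ 70 * m) ^ m

/-- `0 ≤ C(m)`. [folklore] -/
theorem w80Cw_nonneg (m : ℕ) : 0 ≤ w80Cw m := by unfold w80Cw; positivity

/-- `C(m) ≤ (2⁷⁰ m)ᵐ` (the shape `(c m)ᵐ` required by Stewart–Yu). [folklore] -/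
theorem w80Cw_le (m : ℕ) : w80Cw m ≤ (2 ^ 70 * m) ^ m := le_rfl

/-- `C` is monotone in `m ≥ 1`. [folklore] -/
theorem w80Cw_mono {m m' : ℕ} (hm : 1 ≤ m) (h : m ≤ m') : w80Cw m ≤ w80Cw m' := by
  unfold w80Cw
  have hmR : (m : ℝ) ≤ (m' : ℝ) := by exact_mod_cast h
  have h1 : (1 : ℝ) ≤ 2 ^ 70 * (m' : ℝ) := by
    have : (1 : ℝ) ≤ m := by exact_mod_cast hm
    nlinarith
  have h2 : ((2 : ℝ) ^ 70 * (m : ℝ)) ^ m ≤ ((2 : ℝ) ^ 70 * (m' : ℝ)) ^ m :=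
    pow_le_pow_left₀ (by positivity) (by nlinarith) m
  have h3 : ((2 : ℝ) ^ 70 * (m' : ℝ)) ^ m ≤ ((2 : ℝ) ^ 70 * (m' : ℝ)) ^ m' := pow_le_pow_right₀ h1 h
  exact h2.trans h3

namespace W80Par

variable {d : ℕ} (P : W80Par d)

/-- **`U ≤ (2⁶⁹ m)ᵐ · (∏Vⱼ)V_θ · (W + log(2V_θ)) · log(2V_f)`**: the parameter `U` of the machine
against the shape of Proposition 3.8 (`W⋆ ≤ m(10 + log m)(W + log 2V_θ)`,
`G ≤ m(17.1 + 1.45 log m) log(2V_f)`, `m^{2m+1}/m! ≤ eᵐ m^{m+1}`). [cite: Waldschmidt1980, §3.1 (p. 264)] -/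
theorem U_le_Cw :
    P.U ≤ (2 ^ 69 * mR d) ^ (d + 1) * ((∏ j, P.V j) * P.Vθ) * (P.W + Real.log (2 * P.Vθ)) * Real.log (2 * P.Vf) := by
  have hm := two_le_mR P; have hm0 := mR_pos P; have hW := P.hW; have hVθ := P.one_le_Vθ; have hVf := P.hVf1
  have hV := P.one_le_prodV
  set L := Real.log (2 * P.Vθ) with hL
  set Lf := Real.log (2 * P.Vf) with hLf
  have hl2 := Real.log_two_gt_d9; have hl2' := Real.log_two_lt_d9
  have hL2 : Real.log 2 ≤ L := by rw [hL]; exact Real.log_le_log two_pos (by linarith)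
  have hLf2 : Real.log 2 ≤ Lf := by rw [hLf]; exact Real.log_le_log two_pos (by linarith)
  have hL0 : 0 < L := by linarith
  have hLf0 : 0 < Lf := by linarith
  have hlogm : 0 ≤ Real.log (mR d) := Real.log_nonneg (by linarith)
  have hlogm' : Real.log (mR d) ≤ mR d := (Real.log_le_sub_one_of_pos hm0).trans (by linarith)
  -- `W⋆ ≤ m (10 + log m) (W + L)`
  have hWs : P.Wstar ≤ mR d * (10 + Real.log (mR d)) * (P.W + L) := by
    unfold Wstar
    refine max_le ?_ ?_
    · have h1 : (1 : ℝ) * 1 * P.W ≤ mR d * (10 + Real.log (mR d)) * (P.W + L) := by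
        gcongr
        · linarith
        · linarith
        · linarith
      linarith
    · have e : Real.log (2 ^ 13 * mR d * P.Vθ) = 12 * Real.log 2 + Real.log (mR d) + L := by
        rw [hL, Real.log_mul (by positivity) (by linarith), Real.log_mul (by positivity) hm0.ne',
          Real.log_mul two_ne_zero (by linarith), Real.log_pow]; push_cast; ring
      rw [e]
      have h2 : 12 * Real.log 2 + Real.log (mR d) + L ≤ (10 + Real.log (mR d)) * (P.W + L) := by
        nlinarith
      calc mR d * (12 * Real.log 2 + Real.log (mR d) + L) ≤ mR d * ((10 + Real.log (mR d)) * (P.W + L)) :=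
            mul_le_mul_of_nonneg_left h2 hm0.le
        _ = mR d * (10 + Real.log (mR d)) * (P.W + L) := by ring
  -- `G ≤ m (17.1 + 1.45 log m) Lf`
  have hG : P.G ≤ mR d * (17.1 + 1.45 * Real.log (mR d)) * Lf := by
    unfold G
    have e : Real.log (2 ^ 17 * mR d * P.Vf) = 16 * Real.log 2 + Real.log (mR d) + Lf := by
      rw [hLf, Real.log_mul (by positivity) (by linarith), Real.log_mul (by positivity) hm0.ne',
        Real.log_mul two_ne_zero (by linarith), Real.log_pow]; push_cast; ring
    rw [e]
    have h2 : 16 * Real.log 2 + Real.log (mR d) + Lf ≤ (17.1 + 1.45 * Real.log (mR d)) * Lf := by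
      -- `16 log 2 ≤ 16.02 Lf`, `log m ≤ 1.45 log m · Lf` (`Lf ≥ log 2 ≥ 0.693`)
      nlinarith
    calc mR d * (16 * Real.log 2 + Real.log (mR d) + Lf) ≤ mR d * ((17.1 + 1.45 * Real.log (mR d)) * Lf) :=
          mul_le_mul_of_nonneg_left h2 hm0.le
      _ = _ := by ring
  -- `m^{2m+1}/m! ≤ e^m m^{m+1}`
  have hfac : mR d ^ (2 * d + 3) / (d + 1).factorial ≤ Real.exp 1 ^ (d + 1) * mR d ^ (d + 2) := by
    have hfacpos : (0 : ℝ) < (d + 1).factorial := by exact_mod_cast Nat.factorial_pos _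
    have hst := CW77.pow_self_le_exp_mul_factorial (d + 1)
    have em : ((d + 1 : ℕ) : ℝ) = mR d := by unfold mR; push_cast; ring
    rw [em] at hst
    rw [div_le_iff₀ hfacpos]
    calc mR d ^ (2 * d + 3) = mR d ^ (d + 2) * mR d ^ (d + 1) := by rw [← pow_add]; ring_nf
      _ ≤ mR d ^ (d + 2) * (Real.exp 1 ^ (d + 1) * (d + 1).factorial) := mul_le_mul_of_nonneg_left hst (by positivity)
      _ = Real.exp 1 ^ (d + 1) * mR d ^ (d + 2) * (d + 1).factorial := by ring
  -- the constants: `A^m e^m m^{m+1} · m (10 + log m) · m (17.1 + 1.45 log m) ≤ (2^69 m)^m`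
  have hconst : A ^ (d + 1) * (Real.exp 1 ^ (d + 1) * mR d ^ (d + 2)) * (mR d * (10 + Real.log (mR d))) *
      (mR d * (17.1 + 1.45 * Real.log (mR d))) ≤ (2 ^ 69 * mR d) ^ (d + 1) := by
    -- `(10 + log m)(17.1 + 1.45 log m) ≤ 204.1 m²`
    have h1 : (10 + Real.log (mR d)) * (17.1 + 1.45 * Real.log (mR d)) ≤ 204.1 * mR d ^ 2 := by nlinarith
    -- `m^5 ≤ 120 e^m`
    have h2 : mR d ^ 5 ≤ 120 * Real.exp (mR d) := by
      have := Real.pow_div_factorial_le_exp (mR d) hm0.le 5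
      rw [show (Nat.factorial 5 : ℝ) = 120 by norm_num, div_le_iff₀ (by norm_num)] at this
      linarith
    -- `e^m = exp m`
    have he : Real.exp 1 ^ (d + 1) = Real.exp (mR d) := by rw [← Real.exp_nat_mul]; unfold mR; push_cast; ring_nf
    have hexp1 := Real.exp_one_lt_d9
    -- `A^m e^m m^{m+1} m² · 204.1 m² = 204.1 A^m e^m m^m m^5 ≤ 204.1 · 120 · A^m e^{2m} m^m ≤ (2^69 m)^m`
    have h3 : A ^ (d + 1) * (Real.exp 1 ^ (d + 1) * mR d ^ (d + 2)) * (mR d * (10 + Real.log (mR d))) *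
        (mR d * (17.1 + 1.45 * Real.log (mR d))) ≤ 204.1 * 120 * (A ^ (d + 1) * Real.exp (mR d) ^ 2 * mR d ^ (d + 1)) := by
      have hA : (0 : ℝ) ≤ A ^ (d + 1) := by unfold A; positivity
      calc A ^ (d + 1) * (Real.exp 1 ^ (d + 1) * mR d ^ (d + 2)) * (mR d * (10 + Real.log (mR d))) *
            (mR d * (17.1 + 1.45 * Real.log (mR d)))
          = A ^ (d + 1) * Real.exp (mR d) * mR d ^ (d + 1) * mR d ^ 3 *
              ((10 + Real.log (mR d)) * (17.1 + 1.45 * Real.log (mR d))) := by rw [he]; ring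
        _ ≤ A ^ (d + 1) * Real.exp (mR d) * mR d ^ (d + 1) * mR d ^ 3 * (204.1 * mR d ^ 2) := by
            gcongr
        _ = 204.1 * (A ^ (d + 1) * Real.exp (mR d) * mR d ^ (d + 1)) * mR d ^ 5 := by ring
        _ ≤ 204.1 * (A ^ (d + 1) * Real.exp (mR d) * mR d ^ (d + 1)) * (120 * Real.exp (mR d)) := by
            gcongr
        _ = 204.1 * 120 * (A ^ (d + 1) * Real.exp (mR d) ^ 2 * mR d ^ (d + 1)) := by ring
    refine h3.trans ?_
    -- `204.1 · 120 · e^{2m} ≤ (2^19)^m`: `e² ≤ 7.4`, `24492 · 7.4 ≤ 2^19`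
    have he2 : Real.exp (mR d) ^ 2 = Real.exp 2 ^ (d + 1) := by
      rw [← Real.exp_nat_mul, ← Real.exp_nat_mul]; unfold mR; push_cast; ring_nf
    have he74 : Real.exp 2 ≤ 7.4 := by
      have : Real.exp 2 = Real.exp 1 ^ 2 := by rw [← Real.exp_nat_mul]; norm_num
      rw [this]; nlinarith [Real.exp_pos 1]
    have h4 : (204.1 : ℝ) * 120 * Real.exp 2 ^ (d + 1) ≤ (2 ^ 19) ^ (d + 1) := by
      calc (204.1 : ℝ) * 120 * Real.exp 2 ^ (d + 1) ≤ (204.1 * 120) ^ (d + 1) * Real.exp 2 ^ (d + 1) := by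
            gcongr
            have : (1 : ℝ) ≤ 204.1 * 120 := by norm_num
            calc (204.1 : ℝ) * 120 = (204.1 * 120) ^ 1 := (pow_one _).symm
              _ ≤ (204.1 * 120) ^ (d + 1) := pow_le_pow_right₀ this (by omega)
        _ = (204.1 * 120 * Real.exp 2) ^ (d + 1) := by ring
        _ ≤ (2 ^ 19) ^ (d + 1) := by
            apply pow_le_pow_left₀ (by positivity)
            nlinarith
    unfold A
    calc 204.1 * 120 * (((2 : ℝ) ^ 50) ^ (d + 1) * Real.exp (mR d) ^ 2 * mR d ^ (d + 1))
        = (204.1 * 120 * Real.exp 2 ^ (d + 1)) * (((2 : ℝ) ^ 50) ^ (d + 1) * mR d ^ (d + 1)) := by rw [he2]; ring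
      _ ≤ (2 ^ 19) ^ (d + 1) * (((2 : ℝ) ^ 50) ^ (d + 1) * mR d ^ (d + 1)) := by gcongr
      _ = (2 ^ 69 * mR d) ^ (d + 1) := by
          rw [mul_pow, ← mul_assoc, ← pow_mul, ← pow_mul, ← pow_add, ← pow_mul,
            show 19 * (d + 1) + 50 * (d + 1) = 69 * (d + 1) by ring]
  -- assemble
  unfold U
  have hVV : 0 ≤ (∏ j, P.V j) * P.Vθ := by positivity
  have hA : (0 : ℝ) ≤ A ^ (d + 1) := by unfold A; positivity
  have hG0 := P.G_pos.le; have hWs0 : 0 ≤ P.Wstar := by linarith [P.one_le_Wstar]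
  have hF0 : 0 ≤ mR d ^ (2 * d + 3) / ((d + 1).factorial : ℝ) := by positivity
  have step1 : A ^ (d + 1) * (mR d ^ (2 * d + 3) / (d + 1).factorial) * ((∏ j, P.V j) * P.Vθ) * P.Wstar * P.G ≤
      A ^ (d + 1) * (Real.exp 1 ^ (d + 1) * mR d ^ (d + 2)) * ((∏ j, P.V j) * P.Vθ) *
          (mR d * (10 + Real.log (mR d)) * (P.W + L)) * (mR d * (17.1 + 1.45 * Real.log (mR d)) * Lf) := by
    have hc1 : 0 ≤ A ^ (d + 1) * (Real.exp 1 ^ (d + 1) * mR d ^ (d + 2)) * ((∏ j, P.V j) * P.Vθ) :=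
      mul_nonneg (mul_nonneg hA (by positivity)) hVV
    have hc2 : 0 ≤ mR d * (10 + Real.log (mR d)) * (P.W + L) :=
      mul_nonneg (mul_nonneg hm0.le (by linarith)) (by linarith)
    refine mul_le_mul (mul_le_mul (mul_le_mul_of_nonneg_right (mul_le_mul_of_nonneg_left hfac hA) hVV) hWs hWs0
      hc1) hG hG0 (mul_nonneg hc1 hc2)
  refine step1.trans ?_
  have e : A ^ (d + 1) * (Real.exp 1 ^ (d + 1) * mR d ^ (d + 2)) * ((∏ j, P.V j) * P.Vθ) *
      (mR d * (10 + Real.log (mR d)) * (P.W + L)) * (mR d * (17.1 + 1.45 * Real.log (mR d)) * Lf) =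
      (A ^ (d + 1) * (Real.exp 1 ^ (d + 1) * mR d ^ (d + 2)) * (mR d * (10 + Real.log (mR d))) *
        (mR d * (17.1 + 1.45 * Real.log (mR d)))) * (((∏ j, P.V j) * P.Vθ) * (P.W + L) * Lf) := by ring
  rw [e]
  have h0 : 0 ≤ ((∏ j, P.V j) * P.Vθ) * (P.W + L) * Lf := by
    have : 0 ≤ P.W + L := by linarith
    positivity
  calc (A ^ (d + 1) * (Real.exp 1 ^ (d + 1) * mR d ^ (d + 2)) * (mR d * (10 + Real.log (mR d))) *
        (mR d * (17.1 + 1.45 * Real.log (mR d)))) * (((∏ j, P.V j) * P.Vθ) * (P.W + L) * Lf)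
      ≤ (2 ^ 69 * mR d) ^ (d + 1) * (((∏ j, P.V j) * P.Vθ) * (P.W + L) * Lf) := mul_le_mul_of_nonneg_right hconst h0
    _ = (2 ^ 69 * mR d) ^ (d + 1) * ((∏ j, P.V j) * P.Vθ) * (P.W + L) * Lf := by ring

end W80Par

/-! ### The elementary bound `|log α| ≥ 1/H(α)` -/

/-- **`|log q| ≥ 1/H(q)`** for a positive rational `q ≠ 1` (`H = max(|num|, den)`):
`log q ≥ 1 − 1/q ≥ 1/num` if `q > 1`, `log(1/q) ≥ 1 − q ≥ 1/den` if `q < 1`. [folklore] -/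
theorem inv_hgt_le_abs_log (q : ℚ) (hq : 0 < q) (hq1 : q ≠ 1) : 1 / hgt q ≤ |Real.log (q : ℝ)| := by
  have hnum : 0 < q.num := Rat.num_pos.mpr hq
  have hden : 0 < q.den := q.den_pos
  have hqeq : (q : ℝ) = (q.num : ℝ) / (q.den : ℝ) := by
    rw [← Rat.cast_intCast, ← Rat.cast_natCast, ← Rat.cast_div, Rat.num_div_den]
  have hnumR : (0 : ℝ) < q.num := by exact_mod_cast hnum
  have hdenR : (0 : ℝ) < q.den := by exact_mod_cast hden
  have hqR : (0 : ℝ) < q := by exact_mod_cast hq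
  have hH : hgt q = max ((q.num.natAbs : ℕ) : ℝ) (q.den : ℝ) := by unfold hgt; push_cast; rfl
  have hnumabs : ((q.num.natAbs : ℕ) : ℝ) = (q.num : ℝ) := by
    rw [Nat.cast_natAbs, Int.cast_abs, abs_of_pos (by exact_mod_cast hnum)]
  have hHpos : 0 < hgt q := hgt_pos q
  rcases lt_or_gt_of_ne hq1 with hlt | hgt'
  · -- `q < 1`: `num + 1 ≤ den`
    have hnd : q.num + 1 ≤ (q.den : ℤ) := by
      have : (q.num : ℚ) < q.den := by
        have h := Rat.num_div_den q
        have : (q.num : ℚ) / q.den < 1 := by rw [h]; exact hlt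
        rwa [div_lt_one (by exact_mod_cast hden)] at this
      exact_mod_cast this
    have hlog : Real.log (q : ℝ) < 0 := Real.log_neg hqR (by exact_mod_cast hlt)
    rw [abs_of_neg hlog, ← Real.log_inv]
    have h1 := Real.one_sub_inv_le_log_of_pos (inv_pos.mpr hqR)
    rw [inv_inv] at h1
    have h2 : 1 / hgt q ≤ 1 - (q : ℝ) := by
      rw [hqeq, div_le_iff₀ hHpos]
      have hndR : (q.num : ℝ) + 1 ≤ q.den := by exact_mod_cast hnd
      have hdH : (q.den : ℝ) ≤ hgt q := den_le_hgt q
      -- `(1 - num/den) H ≥ (1 - num/den) den = den - num ≥ 1`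
      have h3 : 0 ≤ 1 - (q.num : ℝ) / q.den := by rw [sub_nonneg, div_le_one hdenR]; linarith
      calc (1 : ℝ) ≤ (1 - (q.num : ℝ) / q.den) * q.den := by
            rw [sub_mul, div_mul_cancel₀ _ hdenR.ne']; linarith
        _ ≤ (1 - (q.num : ℝ) / q.den) * hgt q := mul_le_mul_of_nonneg_left hdH h3
    linarith
  · -- `q > 1`: `den + 1 ≤ num`
    have hnd : (q.den : ℤ) + 1 ≤ q.num := by
      have : (q.den : ℚ) < q.num := by
        have h := Rat.num_div_den q
        have : 1 < (q.num : ℚ) / q.den := by rw [h]; exact hgt'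
        rwa [one_lt_div (by exact_mod_cast hden)] at this
      exact_mod_cast this
    have hlog : 0 < Real.log (q : ℝ) := Real.log_pos (by exact_mod_cast hgt')
    rw [abs_of_pos hlog]
    have h1 := Real.one_sub_inv_le_log_of_pos hqR
    have h2 : 1 / hgt q ≤ 1 - (q : ℝ)⁻¹ := by
      rw [hqeq, inv_div, div_le_iff₀ hHpos]
      have hndR : (q.den : ℝ) + 1 ≤ q.num := by exact_mod_cast hnd
      have hnH : (q.num : ℝ) ≤ hgt q := by rw [hH, ← hnumabs]; exact le_max_left _ _
      have h3 : 0 ≤ 1 - (q.den : ℝ) / q.num := by rw [sub_nonneg, div_le_one hnumR]; linarith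
      calc (1 : ℝ) ≤ (1 - (q.den : ℝ) / q.num) * q.num := by
            rw [sub_mul, div_mul_cancel₀ _ hnumR.ne']; linarith
        _ ≤ (1 - (q.den : ℝ) / q.num) * hgt q := mul_le_mul_of_nonneg_left hnH h3
    linarith

/-- `|log q| ≥ e^{−V}` when `log H(q) ≤ V`, for a positive rational `q ≠ 1`. [folklore] -/
theorem exp_neg_le_abs_log (q : ℚ) (hq : 0 < q) (hq1 : q ≠ 1) {V : ℝ} (hV : logHeight₁ q ≤ V) :
    Real.exp (-V) ≤ |Real.log (q : ℝ)| := by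
  refine le_trans ?_ (inv_hgt_le_abs_log q hq hq1)
  have hH : Real.log (hgt q) = logHeight₁ q := by rw [Rat.logHeight₁_eq_log_max]; rfl
  have h1 : hgt q ≤ Real.exp V := by
    rw [← Real.log_le_iff_le_exp (hgt_pos q), hH]; exact hV
  rw [Real.exp_neg, one_div]
  exact inv_anti₀ (hgt_pos q) h1

/-! ### The statement in the shape `hW₂` -/

/-- Two facts about the target exponent `X = C(n+1) ∏Vⱼ (W + log 2V_last) L` (`Vⱼ ≥ 1`, `W > 0`,
`L ≥ log 2`): `X ≤ X/(log 2)^{n+2}` and `V_last + 1 ≤ X`. [folklore] -/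
theorem target_ge {n : ℕ} (V : Fin (n + 1) → ℝ) (hV1 : ∀ j, 1 ≤ V j) {W L : ℝ} (hW : 0 < W)
    (hL : Real.log 2 ≤ L) :
    w80Cw (n + 1) * (∏ j, V j) * (W + Real.log (2 * V (Fin.last n))) * L ≤
        w80Cw (n + 1) * (∏ j, V j) * (W + Real.log (2 * V (Fin.last n))) * L / Real.log 2 ^ (n + 2) ∧
      V (Fin.last n) + 1 ≤ w80Cw (n + 1) * (∏ j, V j) * (W + Real.log (2 * V (Fin.last n))) * L := by
  have hl2 := Real.log_two_gt_d9; have hl2' := Real.log_two_lt_d9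
  have hL0 : 0 < L := by linarith
  have hLn : Real.log 2 ≤ Real.log (2 * V (Fin.last n)) :=
    Real.log_le_log two_pos (by linarith [hV1 (Fin.last n)])
  have hPV : V (Fin.last n) ≤ ∏ j, V j := by
    rw [← Finset.mul_prod_erase _ _ (mem_univ (Fin.last n))]
    have h1 : 1 ≤ ∏ j ∈ (univ : Finset (Fin (n + 1))).erase (Fin.last n), V j := by
      have : ∏ _j ∈ (univ : Finset (Fin (n + 1))).erase (Fin.last n), (1 : ℝ) ≤
          ∏ j ∈ (univ : Finset (Fin (n + 1))).erase (Fin.last n), V j :=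
        prod_le_prod (fun _ _ => zero_le_one) fun j _ => hV1 j
      simpa using this
    have h0 : 0 ≤ V (Fin.last n) := le_trans zero_le_one (hV1 _)
    nlinarith
  have hC : (2 : ℝ) ^ 70 ≤ w80Cw (n + 1) := by
    unfold w80Cw
    calc (2 : ℝ) ^ 70 = (2 ^ 70 * 1) ^ 1 := by norm_num
      _ ≤ (2 ^ 70 * ((n + 1 : ℕ) : ℝ)) ^ 1 := by gcongr; exact_mod_cast Nat.le_add_left 1 n
      _ ≤ (2 ^ 70 * ((n + 1 : ℕ) : ℝ)) ^ (n + 1) := by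
          refine pow_le_pow_right₀ ?_ (Nat.le_add_left 1 n)
          have : (1 : ℝ) ≤ ((n + 1 : ℕ) : ℝ) := by exact_mod_cast Nat.le_add_left 1 n
          nlinarith
  have hX0 : 0 ≤ w80Cw (n + 1) * (∏ j, V j) * (W + Real.log (2 * V (Fin.last n))) * L := by
    have := w80Cw_nonneg (n + 1)
    have : 0 ≤ ∏ j, V j := prod_nonneg fun j _ => le_trans zero_le_one (hV1 j)
    have : 0 ≤ W + Real.log (2 * V (Fin.last n)) := by linarith
    positivity
  constructor
  · have hden : 0 < Real.log 2 ^ (n + 2) := pow_pos (by linarith) _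
    have hden1 : Real.log 2 ^ (n + 2) ≤ 1 := pow_le_one₀ (by linarith) (by linarith)
    rw [le_div_iff₀ hden]
    nlinarith
  · -- `C ∏V (W + log 2V) L ≥ 2^70 · V_last · log 2 · log 2 ≥ V_last + 1`
    have hVl := hV1 (Fin.last n)
    have h0 : 0 ≤ V (Fin.last n) := by linarith
    have hC0 := w80Cw_nonneg (n + 1)
    have hP0 : 0 ≤ ∏ j, V j := le_trans h0 hPV
    have hWL0 : 0 ≤ W + Real.log (2 * V (Fin.last n)) := by linarith
    have h1a : (2 : ℝ) ^ 70 * V (Fin.last n) ≤ w80Cw (n + 1) * ∏ j, V j := mul_le_mul hC hPV h0 hC0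
    have h1b : (2 : ℝ) ^ 70 * V (Fin.last n) * Real.log 2 ≤ w80Cw (n + 1) * (∏ j, V j) * (W + Real.log (2 * V (Fin.last n))) :=
      mul_le_mul h1a (by linarith) (by linarith) (mul_nonneg hC0 hP0)
    have h1 : (2 : ℝ) ^ 70 * V (Fin.last n) * Real.log 2 * Real.log 2 ≤
        w80Cw (n + 1) * (∏ j, V j) * (W + Real.log (2 * V (Fin.last n))) * L :=
      mul_le_mul h1b hL (by linarith) (mul_nonneg (mul_nonneg hC0 hP0) hWL0)
    have hl48 : (0.48 : ℝ) ≤ Real.log 2 * Real.log 2 := by nlinarith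
    have h2 := mul_le_mul_of_nonneg_left hl48 h0
    nlinarith

/-- **Waldschmidt 1980, Proposition 3.8 over `ℚ` with `q = 2`, in the shape `hW₂`** of
`Literature.Barriers.ABC.stewartYu1991_of_yu1990_waldschmidt1980`: for positive rationals
`α₀, …, αₙ ≠ 1` with `[ℚ(√α₀, …, √αₙ) : ℚ] = 2^{n+1}`, sizes `1 ≤ V₀ ≤ ⋯ ≤ Vₙ` with
`max(h(αⱼ), |log αⱼ|) ≤ Vⱼ`, integers `bⱼ` with `h(bⱼ) ≤ W` (`W > 0`) and `Λ = ∑ bⱼ log αⱼ ≠ 0`: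
`|Λ| > exp(−(2⁷⁰(n+1))^{n+1} · V₀⋯Vₙ · (W + log(2Vₙ)) · log(2V_{n−1}) / (log 2)^{n+2})`
(`log(2·1)` for `n = 0`). [cite: Waldschmidt1980, Proposition 3.8 (p. 263)] -/
theorem waldschmidt1980_hW₂ :
    ∀ (n : ℕ) (α : Fin (n + 1) → ℚ) (b : Fin (n + 1) → ℤ) (V : Fin (n + 1) → ℝ) (W : ℝ),
      (∀ j, 0 < α j ∧ α j ≠ 1) →
      Module.finrank ℚ ↥(IntermediateField.adjoin ℚ
          (Set.range fun j => Real.sqrt (α j : ℝ))) = 2 ^ (n + 1) →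
      Monotone V → 1 ≤ V 0 →
      (∀ j, max (logHeight₁ (α j)) |Real.log (α j : ℝ)| ≤ V j) →
      0 < W → (∀ j, logHeight₁ (b j : ℚ) ≤ W) →
      ∑ j, (b j : ℝ) * Real.log (α j : ℝ) ≠ 0 →
      Real.exp (-(w80Cw (n + 1) * (∏ j, V j) * (W + Real.log (2 * V (Fin.last n))) *
          Real.log (2 * (if n = 0 then 1 else V ⟨n - 1, by omega⟩)) / Real.log 2 ^ (n + 2))) <
        |∑ j, (b j : ℝ) * Real.log (α j : ℝ)| := by
  intro n α b V W hα hfin hVmono hV0 hVj hW hWb hΛne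
  classical
  have hV1 : ∀ j, 1 ≤ V j := fun j => hV0.trans (hVmono (Fin.zero_le j))
  have hVlast : ∀ j, V j ≤ V (Fin.last n) := fun j => hVmono (Fin.le_last j)
  have hl2 := Real.log_two_gt_d9; have hl2' := Real.log_two_lt_d9
  -- the last log factor is `≥ log 2`
  set Lf := Real.log (2 * (if n = 0 then 1 else V ⟨n - 1, by omega⟩)) with hLf
  have hLf2 : Real.log 2 ≤ Lf := by
    rw [hLf]; refine Real.log_le_log two_pos ?_
    split_ifs
    · norm_num
    · linarith [hV1 ⟨n - 1, by omega⟩]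
  obtain ⟨htarget, htarget1⟩ := target_ge V hV1 hW hLf2
  -- it suffices to prove the bound without the division by `(log 2)^{n+2}`
  suffices key : Real.exp (-(w80Cw (n + 1) * (∏ j, V j) * (W + Real.log (2 * V (Fin.last n))) * Lf)) <
      |∑ j, (b j : ℝ) * Real.log (α j : ℝ)| by
    refine lt_of_le_of_lt ?_ key
    rw [Real.exp_le_exp, neg_le_neg_iff]; exact htarget
  -- the support of `b`
  set Tsupp : Finset (Fin (n + 1)) := univ.filter (fun j => b j ≠ 0) with hTsupp
  have hTne : Tsupp.Nonempty := by
    by_contra h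
    rw [Finset.not_nonempty_iff_eq_empty] at h
    apply hΛne
    refine sum_eq_zero fun j _ => ?_
    have : b j = 0 := by
      by_contra hb
      have : j ∈ Tsupp := by rw [hTsupp, mem_filter]; exact ⟨mem_univ _, hb⟩
      rw [h] at this; simp at this
    rw [this]; simp
  set i₀ := Tsupp.max' hTne with hi₀
  have hi₀mem : i₀ ∈ Tsupp := Tsupp.max'_mem hTne
  have hbi₀ : b i₀ ≠ 0 := by
    have := hi₀mem; rw [hTsupp, mem_filter] at this; exact this.2
  have hle_i₀ : ∀ j ∈ Tsupp, j ≤ i₀ := fun j hj => Tsupp.le_max' j hj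
  -- the sum over the support
  have hΛsupp : ∑ j, (b j : ℝ) * Real.log (α j : ℝ) = ∑ j ∈ Tsupp, (b j : ℝ) * Real.log (α j : ℝ) := by
    symm
    refine sum_subset (subset_univ _) fun j _ hj => ?_
    have : b j = 0 := by
      by_contra hb
      exact hj (by rw [hTsupp, mem_filter]; exact ⟨mem_univ _, hb⟩)
    rw [this]; simp
  set F : Finset (Fin (n + 1)) := Tsupp.erase i₀ with hF
  have hFlt : ∀ j ∈ F, j < i₀ := by
    intro j hj
    rw [hF, mem_erase] at hj
    exact lt_of_le_of_ne (hle_i₀ j hj.2) hj.1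
  have hΛsplit : ∑ j ∈ Tsupp, (b j : ℝ) * Real.log (α j : ℝ) =
      (b i₀ : ℝ) * Real.log (α i₀ : ℝ) + ∑ j ∈ F, (b j : ℝ) * Real.log (α j : ℝ) := by
    rw [hF, ← Finset.add_sum_erase _ _ hi₀mem]
  -- the elementary bound for the logarithm of `α i₀`
  have hlogi₀ : Real.exp (-V (Fin.last n)) ≤ |Real.log (α i₀ : ℝ)| := by
    refine le_trans (Real.exp_le_exp.mpr (neg_le_neg (hVlast i₀))) ?_
    exact exp_neg_le_abs_log (α i₀) (hα i₀).1 (hα i₀).2 ((le_max_left _ _).trans (hVj i₀))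
  set d := F.card with hd
  rcases Nat.eq_zero_or_pos d with hd0 | hdpos
  · -- a single non-zero coefficient: `Λ = b_{i₀} log α_{i₀}`
    have hF0 : F = ∅ := Finset.card_eq_zero.mp hd0
    rw [hΛsupp, hΛsplit, hF0, sum_empty, add_zero, abs_mul]
    have hb1 : (1 : ℝ) ≤ |(b i₀ : ℝ)| := by exact_mod_cast Int.one_le_abs hbi₀
    calc Real.exp (-(w80Cw (n + 1) * (∏ j, V j) * (W + Real.log (2 * V (Fin.last n))) * Lf))
        < Real.exp (-V (Fin.last n)) := by rw [Real.exp_lt_exp]; linarith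
      _ ≤ |Real.log (α i₀ : ℝ)| := hlogi₀
      _ ≤ |(b i₀ : ℝ)| * |Real.log (α i₀ : ℝ)| := le_mul_of_one_le_left (abs_nonneg _) hb1
  · -- the machine with `d ≥ 1` free logarithms (those of `F`) and `θ = α_{i₀}`
    set emb : Fin d ↪o Fin (n + 1) := F.orderEmbOfFin hd.symm with hemb
    have hemb_mem : ∀ k, emb k ∈ F := fun k => F.orderEmbOfFin_mem hd.symm k
    have hemb_lt : ∀ k, emb k < i₀ := fun k => hFlt _ (hemb_mem k)
    have hn1 : 1 ≤ n := by
      have h1 := hemb_lt ⟨0, hdpos⟩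
      have h2 : (i₀ : ℕ) ≤ n := Nat.lt_succ_iff.mp i₀.isLt
      have h3 : ((emb ⟨0, hdpos⟩ : Fin (n + 1)) : ℕ) < (i₀ : ℕ) := h1
      omega
    have hLf' : Lf = Real.log (2 * V ⟨n - 1, by omega⟩) := by rw [hLf, if_neg (by omega)]
    -- the free sizes are `≤ V_{n-1}`
    have hembV : ∀ k, V (emb k) ≤ V ⟨n - 1, by omega⟩ := by
      intro k
      apply hVmono
      have h1 := hemb_lt k
      have h2 : (i₀ : ℕ) ≤ n := Nat.lt_succ_iff.mp i₀.isLt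
      show emb k ≤ _
      rw [Fin.le_def]
      have h3 : ((emb k : Fin (n + 1)) : ℕ) < (i₀ : ℕ) := h1
      simp only
      omega
    -- the data and the parameters
    set S : CW77.Setup := ⟨d, fun k => α (emb k), α i₀, fun k => (hα _).1, (hα _).1,
      fun k => b (emb k), b i₀, hbi₀⟩ with hSdef
    have hmaxW : 1 ≤ max W 1 := le_max_right _ _
    set P : W80Par S.d := ⟨fun k => V (emb k), V ⟨n - 1, by omega⟩, V (Fin.last n), max W 1,
      fun k => hV1 _, hembV, hV1 _, hVlast _, hmaxW, hdpos⟩ with hPdef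
    -- the hypotheses `W80Hyp`
    have hlogH : ∀ q : ℚ, Real.log (hgt q) = logHeight₁ q := fun q => by rw [Rat.logHeight₁_eq_log_max]; rfl
    have hbW : ∀ j, |((b j : ℤ) : ℝ)| ≤ Real.exp (max W 1) := by
      intro j
      have h1 := hWb j
      rw [Literature.Barriers.ABC.logHeight₁_intCast_eq, Real.log_le_iff_le_exp (by positivity)] at h1
      exact (le_max_left _ _).trans (h1.trans (Real.exp_le_exp.mpr (le_max_left _ _)))
    have hy : S.W80Hyp P := by
      refine ⟨fun k => ?_, fun k => ?_, ?_, ?_, fun k => hbW _, hbW _⟩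
      · show Real.log (hgt (α (emb k))) ≤ V (emb k)
        rw [hlogH]; exact (le_max_left _ _).trans (hVj _)
      · show |Real.log ((α (emb k) : ℚ) : ℝ)| ≤ V (emb k)
        exact (le_max_right _ _).trans (hVj _)
      · show Real.log (hgt (α i₀)) ≤ V (Fin.last n)
        rw [hlogH]; exact ((le_max_left _ _).trans (hVj _)).trans (hVlast _)
      · show |Real.log ((α i₀ : ℚ) : ℝ)| ≤ V (Fin.last n)
        exact ((le_max_right _ _).trans (hVj _)).trans (hVlast _)
    -- the independence of `S.all` modulo squares
    have hindα := CW77.not_isSquare_prod_of_finrank_eq α (fun j => (hα j).1.le) hfin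
    set σ : Fin (S.d + 1) → Fin (n + 1) := fun i => Fin.lastCases i₀ (fun k => emb k) i with hσ
    have hσc : ∀ k : Fin S.d, σ (Fin.castSucc k) = emb k := fun k => by simp only [hσ, Fin.lastCases_castSucc]
    have hσl : σ (Fin.last S.d) = i₀ := by simp only [hσ, Fin.lastCases_last]
    have hσinj : Function.Injective σ := by
      intro i i' h
      induction i using Fin.lastCases with
      | last =>
        induction i' using Fin.lastCases with
        | last => rfl
        | cast k' => rw [hσl, hσc] at h; exact absurd h.symm (ne_of_lt (hemb_lt k'))
      | cast k =>
        induction i' using Fin.lastCases with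
        | last => rw [hσl, hσc] at h; exact absurd h (ne_of_lt (hemb_lt k))
        | cast k' => rw [hσc, hσc] at h; rw [emb.injective h]
    have hall : ∀ i, S.all i = α (σ i) := by
      intro i
      induction i using Fin.lastCases with
      | last => rw [hσl]; unfold CW77.Setup.all; rw [Fin.snoc_last]
      | cast k => rw [hσc]; unfold CW77.Setup.all; rw [Fin.snoc_castSucc]
    have hind : ∀ T : Finset (Fin (S.d + 1)), T.Nonempty → ¬ IsSquare (∏ i ∈ T, S.all i) := by
      intro T hT hsq
      refine hindα (T.map ⟨σ, hσinj⟩) (by simpa using hT) ?_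
      rw [Finset.prod_map]
      simpa [hall] using hsq
    -- the main inequality of the machine
    have hmain := hy.main hind
    -- `S.Λ = Λ`
    have hmapF : (univ : Finset (Fin S.d)).map emb.toEmbedding = F := by
      ext x
      simp only [Finset.mem_map, mem_univ, true_and]
      constructor
      · rintro ⟨k, rfl⟩; exact hemb_mem k
      · intro hx
        have : x ∈ Set.range emb := by rw [hemb, Finset.range_orderEmbOfFin]; exact hx
        obtain ⟨k, hk⟩ := this
        exact ⟨k, hk⟩
    have hΛ : S.Λ = ∑ j, (b j : ℝ) * Real.log (α j : ℝ) := by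
      rw [hΛsupp, hΛsplit]
      unfold CW77.Setup.Λ CW77.Setup.l CW77.Setup.lθ
      simp only [hSdef]
      rw [← hmapF, Finset.sum_map]
      simp only [RelEmbedding.coe_toEmbedding]
      ring
    have habs : |S.Λ₀| ≤ |∑ j, (b j : ℝ) * Real.log (α j : ℝ)| := by rw [← hΛ]; exact S.abs_Λ₀_le
    refine lt_of_le_of_lt ?_ (hmain.trans_le habs)
    rw [Real.exp_le_exp, neg_le_neg_iff]
    -- the exponents: `P.U ≤ (2^69 m)^m (∏_k V(emb k)) V_last (W' + log 2V_last) log(2V_{n-1}) ≤ target`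
    have hU := P.U_le_Cw
    -- `(∏_k V(emb k)) · V_last ≤ ∏_j V_j`
    have hprodV : (∏ k : Fin S.d, V (emb k)) * V (Fin.last n) ≤ ∏ j, V j := by
      have h1 : (∏ k : Fin S.d, V (emb k)) = ∏ j ∈ F, V j := by
        rw [← hmapF, Finset.prod_map]; rfl
      rw [h1]
      have hlastF : Fin.last n ∉ F := by
        intro h
        have h1 := hFlt _ h
        have h2 : (i₀ : ℕ) ≤ n := Nat.lt_succ_iff.mp i₀.isLt
        rw [Fin.lt_def] at h1
        simp at h1
        omega
      have h2 : (∏ j ∈ F, V j) * V (Fin.last n) = ∏ j ∈ insert (Fin.last n) F, V j := by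
        rw [Finset.prod_insert hlastF]; ring
      rw [h2, ← Finset.prod_mul_prod_compl (insert (Fin.last n) F) V]
      have h3 : 1 ≤ ∏ j ∈ (insert (Fin.last n) F)ᶜ, V j := by
        have : ∏ _j ∈ (insert (Fin.last n) F)ᶜ, (1 : ℝ) ≤ ∏ j ∈ (insert (Fin.last n) F)ᶜ, V j :=
          prod_le_prod (fun _ _ => zero_le_one) fun j _ => hV1 j
        simpa using this
      have h0 : 0 ≤ ∏ j ∈ insert (Fin.last n) F, V j := prod_nonneg fun j _ => le_trans zero_le_one (hV1 j)
      nlinarith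
    -- `max W 1 + L ≤ 2.45 (W + L)`; constants
    set L := Real.log (2 * V (Fin.last n)) with hL
    have hL2 : Real.log 2 ≤ L := Real.log_le_log two_pos (by linarith [hV1 (Fin.last n)])
    have hWL : max W 1 + L ≤ 2.45 * (W + L) := by
      have h1 : max W 1 ≤ W + 1 := max_le (by linarith) (by linarith)
      nlinarith
    have hm : S.d + 1 ≤ n + 1 := by
      have hc1 : F.card ≤ Tsupp.card - 1 := by rw [hF, Finset.card_erase_of_mem hi₀mem]
      have hc2 : Tsupp.card ≤ n + 1 := (card_le_univ _).trans (by simp)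
      show d + 1 ≤ n + 1
      omega
    have hCmono : (2 : ℝ) ^ (S.d + 1) * ((2 : ℝ) ^ 69 * mR S.d) ^ (S.d + 1) ≤ w80Cw (n + 1) := by
      have e : (2 : ℝ) ^ (S.d + 1) * ((2 : ℝ) ^ 69 * mR S.d) ^ (S.d + 1) = w80Cw (S.d + 1) := by
        unfold w80Cw mR; rw [← mul_pow]; push_cast; ring
      rw [e]; exact w80Cw_mono (by omega) hm
    have h245 : (2.45 : ℝ) ≤ 2 ^ (S.d + 1) := by
      have : (2 : ℝ) ^ 2 ≤ 2 ^ (S.d + 1) := pow_le_pow_right₀ (by norm_num) (by show 2 ≤ d + 1; omega)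
      nlinarith
    -- assemble
    have hPV0 : 0 ≤ (∏ k : Fin S.d, V (emb k)) * V (Fin.last n) := by
      have : 0 ≤ ∏ k : Fin S.d, V (emb k) := prod_nonneg fun k _ => le_trans zero_le_one (hV1 _)
      have := hV1 (Fin.last n); positivity
    have hC0 : 0 ≤ ((2 : ℝ) ^ 69 * mR S.d) ^ (S.d + 1) := by have := mR_pos P; positivity
    have hLf0 : 0 ≤ Lf := by linarith
    calc P.U ≤ (2 ^ 69 * mR S.d) ^ (S.d + 1) * ((∏ k : Fin S.d, V (emb k)) * V (Fin.last n)) * (max W 1 + L) *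
          Real.log (2 * V ⟨n - 1, by omega⟩) := hU
      _ ≤ (2 ^ 69 * mR S.d) ^ (S.d + 1) * (∏ j, V j) * (2.45 * (W + L)) * Lf := by
          rw [← hLf']
          refine mul_le_mul (mul_le_mul (mul_le_mul_of_nonneg_left hprodV hC0) hWL (by linarith) (by
            have : 0 ≤ ∏ j, V j := prod_nonneg fun j _ => le_trans zero_le_one (hV1 j); positivity)) le_rfl hLf0 ?_
          have : 0 ≤ ∏ j, V j := prod_nonneg fun j _ => le_trans zero_le_one (hV1 j)
          have : 0 ≤ W + L := by linarith
          positivity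
      _ = (2.45 * (2 ^ 69 * mR S.d) ^ (S.d + 1)) * (∏ j, V j) * (W + L) * Lf := by ring
      _ ≤ w80Cw (n + 1) * (∏ j, V j) * (W + L) * Lf := by
          have h1 : 2.45 * ((2 : ℝ) ^ 69 * mR S.d) ^ (S.d + 1) ≤ w80Cw (n + 1) :=
            le_trans (mul_le_mul_of_nonneg_right h245 hC0) hCmono
          have : 0 ≤ ∏ j, V j := prod_nonneg fun j _ => le_trans zero_le_one (hV1 j)
          have : 0 ≤ W + L := by linarith
          gcongr

end Literature.NumberTheory.Transcendental.Waldschmidt1980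

end
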